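import Summits.CriticalPhenomena.PercolationContinuityZ3.Theorems.PercNearOneGluingNoHeavyLowerTailSahiCombTriWCorCore

/-!
# The CO-COVERING CERTIFICATE for `Cor_P ≥ 0`: an explicit injection of demands into targets

Support file of the one-cut programme (crux `NoHeavyLowerTail`, stmt-CriticalPhenomena-4575; cell `prim-masterthm`, seat P5 gen 24; memo
`FROM-prim-masterthm-p5-g24-SANDWICH.md` §7(h)(j), §11).  For an ANTIPODE-FREE test family `P` (`Disjoint P (refl P)`, e.g. every threshold family `{#w ≥ k}` with `2k > n`)
put `T := P ∪ refl P`.  Then the antipodal correlation has the `T`-form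

  `Cor_P(A,B) = #(T ∩ A ∩ B) − #(T ∩ refl A ∩ B)`   (`corP_eq_card_sub_card_of_disjoint`),

which is MODULAR in `B`: the members of `B ∩ T` lying in `A \ refl A` count `+1` (TARGETS), those in `refl A \ A` count `−1` (DEMANDS), the rest `0`.  Hence
(**`corP_nonneg_of_coCover`**) any map `φ` sending each demand `w` to a target `φ w ⊇ w`, injective on the demands, proves `0 ≤ Cor_P(A,B)` for EVERY up-set `B` — the
easy direction of Hall's theorem; the converse (a violated Hall condition is an up-set `B` with `Cor_P(A,B) < 0`) is not formalised.  This is the shape of machine-checkable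
certificates for the outer-layer Kleitman conjecture `ThresholdCorNonneg` at fixed `n`: by the SHIFTING REDUCTION (memo §7(i), proved on paper) it suffices to certify the
LEFT-SHIFTED up-sets `A`, and for `n = 6` all 1173 of them have such injections (computed, `code24/data/olk_injections_n6.json`; so OLK(6, j) is true for all `j`).
No new definitions; unconditional; std axioms. [this work]
-/

namespace Summit.CriticalPhenomena.PercolationContinuityZ3.Theorems

namespace FiveUpSet

open Finset

variable {γ : Type} [DecidableEq γ] [Fintype γ]

/-! ### The co-covering certificate: an explicit injection proves `Cor_P(A, ·) ≥ 0` (appended, gen 24, memo §7(h)(j), §11) -/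

/-- `#(P ∩ A ∩ refl B) = #(refl P ∩ refl A ∩ B)`. [this work] -/
theorem card_inter_inter_refl_eq (P A B : Finset (Finset γ)) : (P ∩ A ∩ refl B).card = (refl P ∩ refl A ∩ B).card := by
  rw [← card_refl (P ∩ A ∩ refl B), refl_inter, refl_inter, refl_refl]

/-- **The `T`-form of the antipodal correlation for an antipode-free test family.**  If `P ∩ refl P = ∅` (e.g. a threshold family `{#w ≥ k}` with `2k > n`) and
`T := P ∪ refl P`, then `Cor_P(A,B) = #(T ∩ A ∩ B) − #(T ∩ refl A ∩ B)` — the form "B meets A at least as often as refl A inside the layers T" of the memo. [this work] -/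
theorem corP_eq_card_sub_card_of_disjoint {P : Finset (Finset γ)} (hP : Disjoint P (refl P)) (A B : Finset (Finset γ)) :
    corP P A B = (((P ∪ refl P) ∩ A ∩ B).card : ℤ) - (((P ∪ refl P) ∩ refl A ∩ B).card : ℤ) := by
  unfold corP
  rw [← card_refl_inter_inter, card_inter_inter_refl_eq]
  have h1 : (P ∪ refl P) ∩ A ∩ B = (P ∩ A ∩ B) ∪ (refl P ∩ A ∩ B) := by
    ext w
    simp only [mem_inter, mem_union]
    tauto
  have h2 : (P ∪ refl P) ∩ refl A ∩ B = (P ∩ refl A ∩ B) ∪ (refl P ∩ refl A ∩ B) := by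
    ext w
    simp only [mem_inter, mem_union]
    tauto
  have d1 : Disjoint (P ∩ A ∩ B) (refl P ∩ A ∩ B) :=
    hP.mono (inter_subset_left.trans inter_subset_left) (inter_subset_left.trans inter_subset_left)
  have d2 : Disjoint (P ∩ refl A ∩ B) (refl P ∩ refl A ∩ B) :=
    hP.mono (inter_subset_left.trans inter_subset_left) (inter_subset_left.trans inter_subset_left)
  rw [h1, h2, card_union_of_disjoint d1, card_union_of_disjoint d2]
  push_cast
  ring

/-- **CO-COVERING CERTIFICATE ⟹ `Cor_P(A,B) ≥ 0` for every up-set `B`.**  Let `P` be antipode-free, `T = P ∪ refl P`, and `A` any family.  The DEMANDS of `A` are the sets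
`w ∈ T` with `wᶜ ∈ A`, `w ∉ A` (weight `−1` in the `B`-modular form of `Cor_P(A,·)`), the TARGETS the sets `t ∈ T` with `t ∈ A`, `tᶜ ∉ A` (weight `+1`).  If a map `φ` sends
every demand to a target CONTAINING it and is injective on the demands, then `0 ≤ Cor_P(A,B)` for every up-set `B` (each demand in `B` drags its own target into `B`).  By Hall's
theorem the converse holds too (not formalised); for intersecting `A` this is the matching / co-covering form of the outer-layer Kleitman conjecture (memo §7(h)(j)), and it is the
shape of the machine-checkable certificates for `ThresholdCorNonneg` at fixed `n` (1173 injections for the left-shifted up-sets of `2^6`, data `code24/data/olk_injections_n6.json`). [this work] -/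
theorem corP_nonneg_of_coCover {P A : Finset (Finset γ)} (hP : Disjoint P (refl P)) (φ : Finset γ → Finset γ)
    (hφ : ∀ w ∈ ((P ∪ refl P) ∩ refl A) \ A, φ w ∈ ((P ∪ refl P) ∩ A) \ refl A ∧ w ⊆ φ w)
    (hinj : Set.InjOn φ ↑(((P ∪ refl P) ∩ refl A) \ A))
    {B : Finset (Finset γ)} (hB : IsUpperSet (B : Set (Finset γ))) : 0 ≤ corP P A B := by
  rw [corP_eq_card_sub_card_of_disjoint hP]
  set T := P ∪ refl P with hT
  -- split both counts along `A ∩ refl A`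
  have e1 := card_sdiff_add_card_inter (T ∩ A ∩ B) (refl A)
  have e2 := card_sdiff_add_card_inter (T ∩ refl A ∩ B) A
  have e3 : T ∩ A ∩ B ∩ refl A = T ∩ refl A ∩ B ∩ A := by
    ext w
    simp only [mem_inter]
    tauto
  -- the injection of demands met by `B` into targets met by `B`
  have key : ((T ∩ refl A ∩ B) \ A).card ≤ ((T ∩ A ∩ B) \ refl A).card := by
    refine Finset.card_le_card_of_injOn φ ?_ ?_
    · intro w hw
      rw [mem_coe, mem_sdiff, mem_inter, mem_inter] at hw
      have hw' : w ∈ (T ∩ refl A) \ A := mem_sdiff.2 ⟨mem_inter.2 ⟨hw.1.1.1, hw.1.1.2⟩, hw.2⟩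
      obtain ⟨h1, h2⟩ := hφ w hw'
      rw [mem_sdiff, mem_inter] at h1
      rw [mem_coe, mem_sdiff, mem_inter, mem_inter]
      exact ⟨⟨⟨h1.1.1, h1.1.2⟩, hB h2 hw.1.2⟩, h1.2⟩
    · intro w hw w' hw' h
      rw [mem_coe, mem_sdiff, mem_inter, mem_inter] at hw hw'
      exact hinj (mem_coe.2 (mem_sdiff.2 ⟨mem_inter.2 ⟨hw.1.1.1, hw.1.1.2⟩, hw.2⟩))
        (mem_coe.2 (mem_sdiff.2 ⟨mem_inter.2 ⟨hw'.1.1.1, hw'.1.1.2⟩, hw'.2⟩)) h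
  rw [e3] at e1
  have : ((T ∩ refl A ∩ B).card : ℤ) ≤ (T ∩ A ∩ B).card := by
    have := key
    zify at e1 e2 this
    linarith
  linarith

end FiveUpSet

end Summit.CriticalPhenomena.PercolationContinuityZ3.Theorems
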